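import Literature.Topology.FourManifolds.RegularFibreLift
import Mathlib.Geometry.Manifold.MFDeriv.Tangent
import Mathlib.LinearAlgebra.FiniteDimensional.Lemmas
import HarnessLib

/-!
# The tangent space of a regular fibre: `d(incl)` is injective with image `ker df`

Topic `Literature/Topology/FourManifolds` (sequel of `RegularFibre.lean`; fact seat
`provefact-Literature.Geometry.Symplectic.Oba2016_s-add47373d4`: vectors of `ker df` tangent to the
fibre of a Lefschetz fibration are tangent vectors of the fibre *manifold*).  Everything is
proved; no definitions, no named facts.

* `SliceChartFamilyCodim.mfderiv_extend_mfderiv_val` — in the slice chart at `q`, the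
  differential of the inclusion `S → M` reads `w ↦ appendCLE hab (w, 0)`;
  `injective_mfderiv_val` — hence it is injective (Lee 2012, Prop. 5.37 / Thm. 5.8);
* `RegularFibreOn.injective_mfderiv_incl`, `RegularFibreOn.mfderiv_comp_mfderiv_incl`
  (`df ∘ d(incl) = 0`), `RegularFibreOn.exists_mfderiv_incl_eq` — **`T_q F = ker df`**: every
  vector killed by `df` at a point of the fibre is the image of a tangent vector of the fibre
  (dimension count, Lee 2012, Prop. 5.38).

## References

* J. M. Lee, *Introduction to Smooth Manifolds*, 2nd ed., GTM 218 (2012), Thm. 5.8,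
  Props. 5.37–5.38. [LeeSmoothManifolds2013]
-/

open scoped Manifold ContDiff Topology
open Set Function

noncomputable section

namespace Literature.Topology.FourManifolds

universe u

variable {N' a b : ℕ} {H : Type*} [TopologicalSpace H]
  {I : ModelWithCorners ℝ (EuclideanSpace ℝ (Fin N')) H}
  {M : Type u} [TopologicalSpace M] [ChartedSpace H M] {hab : a + b = N'}

namespace SliceChartFamilyCodim

variable {S : Set M} (Ψ : SliceChartFamilyCodim I hab S)

/-- **The inclusion of a slice subset read to first order**: for `q ∈ S` and `w ∈ T_q S`,
`d((Ψ.chart q).extend I)_{q} (d(val)_q w) = appendCLE hab (w, 0)` — the inclusion reads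
`u ↦ (Ψ.chart q)⁻¹ (I⁻¹ (appendCLE hab (u, 0)))` in the level chart, whose own differential at
`q` is the identity. [cite: LeeSmoothManifolds2013, Thm. 5.8] -/
theorem mfderiv_extend_mfderiv_val [IsManifold I ∞ M] (q : S) (w : EuclideanSpace ℝ (Fin a)) :
    letI := Ψ.chartedSpace
    mfderiv I 𝓘(ℝ, EuclideanSpace ℝ (Fin N')) ((Ψ.chart q).extend I) q.1
      (mfderiv (𝓡 a) I (Subtype.val : S → M) q w) = appendCLE hab (w, 0) := by
  letI := Ψ.chartedSpace
  haveI := Ψ.isManifold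
  -- the two smooth maps `ext_M ∘ val` and `A ∘ ext_S` agree near `q`
  set A : EuclideanSpace ℝ (Fin a) →L[ℝ] EuclideanSpace ℝ (Fin N') :=
    (appendCLE hab : (EuclideanSpace ℝ (Fin a) × EuclideanSpace ℝ (Fin b)) →L[ℝ]
      EuclideanSpace ℝ (Fin N')).comp (ContinuousLinearMap.inl ℝ _ _) with hA
  have hAapp : ∀ u, A u = appendCLE hab (u, 0) := fun u => rfl
  have hev : ((Ψ.chart q).extend I ∘ (Subtype.val : S → M)) =ᶠ[𝓝 q]
      fun q' => A (extChartAt (𝓡 a) q q') := by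
    have hsrc : (chartAt (EuclideanSpace ℝ (Fin a)) q).source ∈ 𝓝 q :=
      (chartAt _ q).open_source.mem_nhds (mem_chart_source _ q)
    filter_upwards [hsrc] with q' hq'
    rw [hAapp]
    show I (Ψ.chart q q'.1) = appendCLE hab (extChartAt (𝓡 a) q q', 0)
    rw [extChartAt, OpenPartialHomeomorph.extend_coe, comp_apply, modelWithCornersSelf_coe, id_eq]
    exact (Ψ.appendCLE_levelChart hq').symm
  -- differentiability
  have hval : MDifferentiableAt (𝓡 a) I (Subtype.val : S → M) q :=
    Ψ.contMDiff_subtype_val.mdifferentiableAt (by simp)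
  have hext : MDifferentiableAt I 𝓘(ℝ, EuclideanSpace ℝ (Fin N')) ((Ψ.chart q).extend I) q.1 :=
    ((Ψ.chart q).contMDiffAt_extend (Ψ.mem_maximalAtlas q) (Ψ.mem_source q)).mdifferentiableAt (by simp)
  have hchart : HasMFDerivAt (𝓡 a) 𝓘(ℝ, EuclideanSpace ℝ (Fin a)) (extChartAt (𝓡 a) q) q
      (tangentCoordChange (𝓡 a) q q q) := by
    have h := hasMFDerivAt_extChartAt (I := 𝓡 a) (mem_chart_source (EuclideanSpace ℝ (Fin a)) q)
    rwa [mfderiv_chartAt_eq_tangentCoordChange (I := 𝓡 a) (mem_chart_source _ q)] at h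
  have hR : HasMFDerivAt (𝓡 a) 𝓘(ℝ, EuclideanSpace ℝ (Fin N')) (fun q' => A (extChartAt (𝓡 a) q q')) q
      (A.comp (tangentCoordChange (𝓡 a) q q q)) :=
    A.hasFDerivAt.hasMFDerivAt.comp q hchart
  have hL : HasMFDerivAt (𝓡 a) 𝓘(ℝ, EuclideanSpace ℝ (Fin N')) ((Ψ.chart q).extend I ∘ (Subtype.val : S → M)) q
      ((mfderiv I 𝓘(ℝ, EuclideanSpace ℝ (Fin N')) ((Ψ.chart q).extend I) q.1).comp
        (mfderiv (𝓡 a) I (Subtype.val : S → M) q)) :=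
    hext.hasMFDerivAt.comp q hval.hasMFDerivAt
  have heq := hasMFDerivAt_unique hL (hR.congr_of_eventuallyEq hev)
  have h1 := ContinuousLinearMap.ext_iff.1 heq w
  have h2 : tangentCoordChange (𝓡 a) q q q w = w := tangentCoordChange_self (mem_extChartAt_source q)
  have h3 : (A.comp (tangentCoordChange (𝓡 a) q q q)) w = appendCLE hab (w, 0) := by
    rw [ContinuousLinearMap.comp_apply, h2]; rfl
  exact h1.trans h3

/-- **The differential of the inclusion of a slice subset is injective.**
[cite: LeeSmoothManifolds2013, Thm. 5.8] -/
theorem injective_mfderiv_val [IsManifold I ∞ M] (q : S) :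
    letI := Ψ.chartedSpace
    Injective (mfderiv (𝓡 a) I (Subtype.val : S → M) q) := by
  letI := Ψ.chartedSpace
  intro v w hvw
  have h := congrArg (mfderiv I 𝓘(ℝ, EuclideanSpace ℝ (Fin N')) ((Ψ.chart q).extend I) q.1) hvw
  have h' : appendCLE hab (v, 0) = appendCLE hab (w, 0) := by
    rw [← Ψ.mfderiv_extend_mfderiv_val q v, ← Ψ.mfderiv_extend_mfderiv_val q w]; exact h
  exact (Prod.ext_iff.1 ((appendCLE hab).injective h')).1

end SliceChartFamilyCodim

namespace RegularFibreOn

variable {f : M → EuclideanSpace ℝ (Fin b)} {c : EuclideanSpace ℝ (Fin b)} {U : Set M}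

/-- **`d(incl)` is injective** at every point of the regular fibre.
[cite: LeeSmoothManifolds2013, Prop. 5.37] -/
theorem injective_mfderiv_incl [IsManifold I ∞ M] (h : IsRegularFibreOn I hab f c U) (q : RegularFibreOn h) :
    Injective (mfderiv (𝓡 a) I (incl h) q) :=
  h.sliceChartFamily.injective_mfderiv_val q

/-- **`df ∘ d(incl) = 0`** along the regular fibre (`f ∘ incl` is constant).
[cite: LeeSmoothManifolds2013, Prop. 5.38] -/
theorem mfderiv_comp_mfderiv_incl [IsManifold I ∞ M] (h : IsRegularFibreOn I hab f c U)
    (q : RegularFibreOn h) (w : EuclideanSpace ℝ (Fin a)) :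
    mfderiv I 𝓘(ℝ, EuclideanSpace ℝ (Fin b)) f (incl h q) (mfderiv (𝓡 a) I (incl h) q w) = 0 := by
  have hf : MDifferentiableAt I 𝓘(ℝ, EuclideanSpace ℝ (Fin b)) f (incl h q) :=
    h.contMDiff.mdifferentiableAt (by simp)
  have hi : MDifferentiableAt (𝓡 a) I (incl h) q := (contMDiff_incl h).mdifferentiableAt (by simp)
  have h1 := mfderiv_comp q hf hi
  have h2 : mfderiv (𝓡 a) 𝓘(ℝ, EuclideanSpace ℝ (Fin b)) (f ∘ incl h) q = 0 := by
    rw [comp_incl]; exact mfderiv_const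
  have h3 := ContinuousLinearMap.ext_iff.1 (h1.symm.trans h2) w
  exact h3

/-- **`T_q F = ker df`**: at a point of the regular fibre, every vector killed by `df` is the
image under `d(incl)` of a (unique) tangent vector of the fibre — `d(incl)` is injective from
dimension `a`, `ker df` has dimension `N - b = a`. [cite: LeeSmoothManifolds2013, Prop. 5.38] -/
theorem exists_mfderiv_incl_eq [IsManifold I ∞ M] (h : IsRegularFibreOn I hab f c U) (q : RegularFibreOn h)
    {v : EuclideanSpace ℝ (Fin N')} (hv : mfderiv I 𝓘(ℝ, EuclideanSpace ℝ (Fin b)) f (incl h q) v = 0) :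
    ∃ w : EuclideanSpace ℝ (Fin a), mfderiv (𝓡 a) I (incl h) q w = v := by
  set L : EuclideanSpace ℝ (Fin a) →L[ℝ] EuclideanSpace ℝ (Fin N') := mfderiv (𝓡 a) I (incl h) q with hL
  set D : EuclideanSpace ℝ (Fin N') →L[ℝ] EuclideanSpace ℝ (Fin b) :=
    mfderiv I 𝓘(ℝ, EuclideanSpace ℝ (Fin b)) f (incl h q) with hD
  have hsurj : Surjective D := h.surjective_mfderiv (incl_mem h q) (apply_incl h q)
  have hinj : Injective L := injective_mfderiv_incl h q
  have hle : LinearMap.range (L : EuclideanSpace ℝ (Fin a) →ₗ[ℝ] EuclideanSpace ℝ (Fin N')) ≤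
      LinearMap.ker (D : EuclideanSpace ℝ (Fin N') →ₗ[ℝ] EuclideanSpace ℝ (Fin b)) := by
    rintro _ ⟨w, rfl⟩
    exact mfderiv_comp_mfderiv_incl h q w
  have hrank_range : Module.finrank ℝ (LinearMap.range (L : EuclideanSpace ℝ (Fin a) →ₗ[ℝ] EuclideanSpace ℝ (Fin N'))) = a := by
    rw [LinearMap.finrank_range_of_inj hinj, finrank_euclideanSpace_fin]
  have hrank_ker : Module.finrank ℝ (LinearMap.ker (D : EuclideanSpace ℝ (Fin N') →ₗ[ℝ] EuclideanSpace ℝ (Fin b))) = a := by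
    have h1 := LinearMap.finrank_range_add_finrank_ker (D : EuclideanSpace ℝ (Fin N') →ₗ[ℝ] EuclideanSpace ℝ (Fin b))
    rw [LinearMap.range_eq_top.2 hsurj, finrank_top, finrank_euclideanSpace_fin,
      finrank_euclideanSpace_fin] at h1
    omega
  have heq := Submodule.eq_of_le_of_finrank_eq hle (by rw [hrank_range, hrank_ker])
  have hv' : v ∈ LinearMap.ker (D : EuclideanSpace ℝ (Fin N') →ₗ[ℝ] EuclideanSpace ℝ (Fin b)) := hv
  rw [← heq] at hv'
  obtain ⟨w, hw⟩ := hv'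
  exact ⟨w, hw⟩

end RegularFibreOn

end Literature.Topology.FourManifolds

end
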